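import Mathlib
import Summits.Parity.BatemanHorn.Theses.IsogenyRedei

/-!
# Crux idea `divisor-triangle-web` — first lemmas (crux stmt-Parity-11585, QuadraticOmegaParity)

The exact DIVISOR-TRIANGLE identity for a monic quadratic `f = X² + bX + d`:
for every `u` and every factorisation `f(u) = c·k`,
  `f(u) · f(u + c) = c² · f(u + k)`.
(Gaussian form for `f = X²+1`: `(u+i)(u+c-i) = c·(u+k+i)`.)

Consequences typed below (Props, not proved here except the identities):
* parity-check law for `ε = (-1)^{ω(f(·))}` on each triangle `{u, u+c, u+k}`;
* the RUNG `BothParitiesOften` (both parities of `ω(f(n))` occur ≫ x/log x times), to be derived from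
  the two analytic stubs `OddPrimePairSupply`, `FarPointSecondMoment` (+ Turán–Kubilius along `f`);
* the exact transfer identity `WebTransfer` (1-point sum over far points = twisted 2-point sum over
  prime divisor-shifts), the crux-level object of the card.
-/

namespace Summit.Parity.BatemanHorn.Cruxes.QuadraticOmegaParity.DivisorTriangleWeb

open scoped BigOperators
open Filter Finset ArithmeticFunction

/-- The divisor-triangle identity for `X² + 1` (PROVED). -/
theorem triangle_identity_sq_add_one (u c k : ℤ) (h : u ^ 2 + 1 = c * k) :
    (u ^ 2 + 1) * ((u + c) ^ 2 + 1) = c ^ 2 * ((u + k) ^ 2 + 1) := by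
  linear_combination (c * k + 2 * c * u + u ^ 2 + 1) * h

/-- The divisor-triangle identity for every MONIC quadratic `X² + bX + d` (PROVED). -/
theorem triangle_identity_monic (b d u c k : ℤ) (h : u ^ 2 + b * u + d = c * k) :
    (u ^ 2 + b * u + d) * ((u + c) ^ 2 + b * (u + c) + d)
      = c ^ 2 * ((u + k) ^ 2 + b * (u + k) + d) := by
  linear_combination (c * k + 2 * c * u + b * c + u ^ 2 + b * u + d) * h

/-- `ε f n = (-1)^{ω(f(n))}` with the crux's own encoding (`toNat`, `cardDistinctFactors`). -/
noncomputable def eps (f : Polynomial ℤ) (n : ℕ) : ℤ :=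
  (-1) ^ cardDistinctFactors ((f.eval (n : ℤ)).toNat)

/-- The sign type of the triangle based at `u` with divisor `c` (and codivisor `k = f(u)/c`):
`s = (-1)^{ω(gcd(f u, f(u+c))) + ω(c) + ω(gcd(c, f(u+k)))}`. Odd type (`s = -1`) forces a square
divisor of `f(u+k)`. -/
noncomputable def triType (f : Polynomial ℤ) (u c : ℕ) : ℤ :=
  let fu := (f.eval (u : ℤ)).toNat
  let k := fu / c
  (-1) ^ (cardDistinctFactors (Nat.gcd fu ((f.eval ((u + c : ℕ) : ℤ)).toNat))
        + cardDistinctFactors c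
        + cardDistinctFactors (Nat.gcd c ((f.eval ((u + k : ℕ) : ℤ)).toNat)))

/-- PARITY-CHECK LAW (provable now from the identity + `ω(AB) = ω(A)+ω(B)-ω(gcd)`): for monic
quadratic `f` with positive values, every triangle `{u, u+c, u+f(u)/c}` (`c ∣ f(u)`) satisfies
`ε(u)·ε(u+c)·ε(u+k) = triType f u c`. -/
def ParityCheckLaw : Prop :=
  ∀ f : Polynomial ℤ, f.Monic → f.natDegree = 2 → (∀ n : ℕ, 0 < f.eval (n : ℤ)) →
    ∀ u c : ℕ, 0 < c → c ∣ (f.eval (u : ℤ)).toNat →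
      eps f u * eps f (u + c) * eps f (u + (f.eval (u : ℤ)).toNat / c) = triType f u c

/-- The set of prime pairs `(u,p)` with `u ≤ x`, `p ∣ u²+1`, whose far point `w = u + (u²+1)/p`
is `≤ x`, of a given type `s ∈ {1,-1}` (here for `f = X²+1`). -/
noncomputable def primePairs (x : ℕ) (s : ℤ) : Finset (ℕ × ℕ) :=
  ((Icc 1 x) ×ˢ (Icc 1 (x ^ 2 + 1))).filter (fun q : ℕ × ℕ =>
    q.2.Prime ∧ q.2 ∣ q.1 ^ 2 + 1 ∧ q.1 + (q.1 ^ 2 + 1) / q.2 ≤ x ∧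
      triType (Polynomial.X ^ 2 + 1) q.1 q.2 = s)

/-- Far-point multiplicity `mult_x(w) = #{(u,p) prime pair (either type) with u + (u²+1)/p = w}`. -/
noncomputable def farMult (x w : ℕ) : ℕ :=
  (((Icc 1 x) ×ˢ (Icc 1 (x ^ 2 + 1))).filter (fun q : ℕ × ℕ =>
    q.2.Prime ∧ q.2 ∣ q.1 ^ 2 + 1 ∧ q.1 + (q.1 ^ 2 + 1) / q.2 = w)).card

/-- STUB A (Type-I prime counting + accident densities; numerics: odd ≈ 0.30·x/log x,
even ≈ 2.0·x/log x at x ≤ 3·10⁵): both types of prime pairs have supply ≫ x / log x. -/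
def OddPrimePairSupply : Prop :=
  ∀ s : ℤ, (s = 1 ∨ s = -1) → ∃ c : ℝ, 0 < c ∧ ∀ᶠ x : ℕ in atTop,
    c * (x : ℝ) / Real.log x ≤ ((primePairs x s).card : ℝ)

/-- STUB B (two-dimensional upper-bound sieve; numerics: Σ mult² ≈ 2.65·Σ mult at x ≤ 3·10⁵):
the far-point multiplicities have bounded second moment relative to the first. -/
def FarPointSecondMoment : Prop :=
  ∃ C : ℝ, 0 < C ∧ ∀ᶠ x : ℕ in atTop,
    (∑ w ∈ Icc 1 x, ((farMult x w : ℝ) ^ 2)) ≤ C * (x : ℝ) / Real.log x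

/-- The RUNG (target theorem of the line's first stage; in print only ≫ log x via Pell families):
for every monic irreducible quadratic `f` with positive values... here for `f = X² + 1`:
both parities of `ω(n²+1)` occur for ≫ x/log x integers `n ≤ x`. -/
def BothParitiesOften : Prop :=
  ∀ v : ℕ, v < 2 → ∃ c : ℝ, 0 < c ∧ ∀ᶠ x : ℕ in atTop,
    c * (x : ℝ) / Real.log x ≤
      (((Icc 1 x).filter (fun n : ℕ => cardDistinctFactors (n ^ 2 + 1) % 2 = v)).card : ℝ)

/-- Turán–Kubilius second moment of `ω(n²+1)` along `n ≤ x` (theorem in print: Halberstam 1956;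
numerics 1.73·x(log log x)²). -/
def TKSecondMoment : Prop :=
  ∃ C : ℝ, 0 < C ∧ ∀ᶠ x : ℕ in atTop,
    (∑ n ∈ Icc 1 x, ((cardDistinctFactors (n ^ 2 + 1) : ℝ) ^ 2))
      ≤ C * (x : ℝ) * (Real.log (Real.log x)) ^ 2

/-- Composition claim of the rung (the 99%-forcing argument; provable from the three inputs and
`ParityCheckLaw` by a Cauchy–Schwarz chain — no further number theory). -/
def RungFromWeb : Prop :=
  ParityCheckLaw → OddPrimePairSupply → FarPointSecondMoment → TKSecondMoment → BothParitiesOften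

/-- EXACT WEB TRANSFER (crux-level object): the multiplicity-weighted 1-point sum of `ε` over far
points equals the type-twisted 2-point sum over prime divisor-shifts (finite combinatorics +
`ParityCheckLaw`). Any bias `b` of `ε` must therefore be carried LINEARLY by a 2-point
correlation along the web. -/
def WebTransfer : Prop :=
  ∀ x : ℕ, (∑ w ∈ Icc 1 x, (farMult x w : ℤ) * eps (Polynomial.X ^ 2 + 1) w)
    = ∑ q ∈ (primePairs x 1 ∪ primePairs x (-1)),
        triType (Polynomial.X ^ 2 + 1) q.1 q.2 * eps (Polynomial.X ^ 2 + 1) q.1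
          * eps (Polynomial.X ^ 2 + 1) (q.1 + q.2)

/-- The crux itself, by name (the line's horizon; the web supplies its algebraic half exactly). -/
example : Prop := Summit.Parity.BatemanHorn.Theses.IsogenyRedei.QuadraticOmegaParity

end Summit.Parity.BatemanHorn.Cruxes.QuadraticOmegaParity.DivisorTriangleWeb
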